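import Summits.CriticalPhenomena.PercolationContinuityZ3.Theorems.PercNearOneGluingNoHeavyLowerTailCubicThreePointTerminalClosure
import Mathlib.Tactic.Ring
import Mathlib.Tactic.Linarith
import Mathlib.Tactic.Positivity
import HarnessLib

/-!
# `NoHeavyLowerTail` (stmt-CriticalPhenomena-4575) — hub-edge certificate, `Hb` side, Bernstein piece 3

Support file (prover prim-gen-kcluster gen 10, k-cluster line; `--supports stmt-CriticalPhenomena-4575`).  Pure polynomial algebra over `ℝ`;
no definitions, no named facts, no sorries.  One of the seven exact certificate pieces behind the HUB-EDGE THEOREM (assembled in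
`…CubicThreePointHubEdge`): for the smallest non-series–parallel three-terminal graph `H₂ = K_{2,3} +` hub edge (two hubs with arms
`a,b,c` / `A,B,C` to the terminals, hub–hub edge of probability `p`), the three-point law is the segment `L_p = (1−p)·w + p·z` between the
parallel composition `w = x ⊙ y` of the two star laws (`K_{2,3}`; the `join` of `…CubicThreePointSeriesParallel`) and the MERGED star `z`
(arms `a ⊕ A = a + A − aA`, …).  `Hb(L_p)` is a cubic in `p` with Bernstein coefficients `Hb(w)`, `Hb(w) + ⅓∇Hb(w)·(z−w)`,
`Hb(z) − ⅓∇Hb(z)·(z−w)`, `Hb(z)`.  THIS FILE: (three times) the third coefficient, minus its share of the regime multiplier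
`(q − t)·E₁`, written in the box variables `x, x' = 1 − x`, is a polynomial with NONNEGATIVE INTEGER coefficients
(`hubEdge_D3`, 0 monomials; the identity holds in the free ring `ℤ[x, x']`, found by LP over the tensor-Bernstein basis and verified
exactly), hence `≥ 0` on `[0,1]⁶` (`hubEdge_D3_nonneg`).  Cells `(q,u₁,u₂,u₃,t) = (P(a|b|c),P(ab|c),P(ac|b),P(bc|a),P(abc))`, forms
`Ha = t·AG − e₃`, `Hb = q·AG − e₃` of `…CubicThreePointTerminalClosure`.  Memo: run/shared/lean/prim/prim-gen-kcluster/KCLUSTER-gen10.md §3.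
[cite: Gladkov2024StrongFKG, Cor. 4.2 (the quadratic form AG of the cell)]
-/

namespace Summit.CriticalPhenomena.PercolationContinuityZ3.Theorems

namespace CubicThreePointHub

open CubicThreePointTerminal

set_option maxRecDepth 16384 in
set_option maxHeartbeats 4000000 in
/-- Certificate identity (Hb side, piece 3) in the free variables `x, x'` (no relation `x' = 1 − x` is used): the left side equals a
polynomial with nonnegative integer coefficients. [folklore] -/
theorem hubEdge_D3 {a a' b b' c c' A A' B B' C C' ma na mb nb mc nc qz z₁ z₂ z₃ tz : ℝ}
    (hma : ma = a * A + a * A' + a' * A) (hna : na = a' * A') (hmb : mb = b * B + b * B' + b' * B) (hnb : nb = b' * B')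
    (hmc : mc = c * C + c * C' + c' * C) (hnc : nc = c' * C')
    (hqz : qz = (na * nb * nc + ma * nb * nc + na * mb * nc + na * nb * mc)) (hz₁ : z₁ = ma * mb * nc) (hz₂ : z₂ = ma * mc * nb)
    (hz₃ : z₃ = mb * mc * na) (htz : tz = ma * mb * mc) :
    Hb qz z₁ z₂ z₃ tz - (qz - tz) * ((a' * a' * ((b' * b' * (c' * c' * (A * (A' * (B * (B' * (C * (C')))))) + c * (c' * (A * (A' * (B * (B' * (C' * C' + C * (C')))))))))
        + b * (b' * ((c' * c' * (A * (A' * (B' * B' * (C * (C')) + B * (B' * (C * (C'))))))) + c * (c' * (A * (A' * ((B' * B' * (C' * C' + C * (C')))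
        + B * (B' * (C' * C' + C * (C'))))))))))) + a * (a' * ((b' * b' * ((c' * c' * (A' * A' * (B * (B' * (C * (C')))) + A * (A' * (B * (B' * (C * (C')))))))
        + c * (c' * ((A' * A' * (B * (B' * (C' * C' + C * (C'))))) + A * (A' * (B * (B' * (C' * C' + C * (C')))))))))
        + b * (b' * ((c' * c' * ((A' * A' * (B' * B' * (C * (C')) + B * (B' * (C * (C'))))) + A * (A' * (B' * B' * (C * (C')) + B * (B' * (C * (C')))))))
        + c * (c' * ((A' * A' * ((B' * B' * (C' * C' + C * (C'))) + B * (B' * (C' * C' + C * (C'))))) + A * (A' * ((B' * B' * (C' * C' + C * (C')))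
        + B * (B' * (C' * C' + C * (C'))))))))))))
    = 0 := by
  subst hma hna hmb hnb hmc hnc hqz hz₁ hz₂ hz₃ htz
  simp only [Hb]
  ring

set_option maxRecDepth 16384 in
set_option maxHeartbeats 4000000 in
/-- On the box `[0,1]⁶` (cells in the tree's star / parallel-composition form): the third Bernstein piece (Hb side) dominates its share of the
regime multiplier. [folklore] -/
theorem hubEdge_D3_nonneg {a b c A B C qz z₁ z₂ z₃ tz : ℝ}
    (hqz : qz = 1 - ((a + A - a * A) * (b + B - b * B) + (a + A - a * A) * (c + C - c * C) + (b + B - b * B) * (c + C - c * C)) + 2 * ((a + A - a * A) * (b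
        + B - b * B) * (c + C - c * C)))
    (hz₁ : z₁ = (a + A - a * A) * (b + B - b * B) * (1 - (c + C - c * C)))
    (hz₂ : z₂ = (a + A - a * A) * (c + C - c * C) * (1 - (b + B - b * B)))
    (hz₃ : z₃ = (b + B - b * B) * (c + C - c * C) * (1 - (a + A - a * A)))
    (htz : tz = (a + A - a * A) * (b + B - b * B) * (c + C - c * C)) :
    0 ≤ Hb qz z₁ z₂ z₃ tz - (qz - tz) * (((1 - a) * (1 - a) * (((1 - b) * (1 - b) * ((1 - c) * (1 - c) * (A * ((1 - A) * (B * ((1 - B) * (C * ((1 - C)))))))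
        + c * ((1 - c) * (A * ((1 - A) * (B * ((1 - B) * ((1 - C) * (1 - C) + C * ((1 - C))))))))))
        + b * ((1 - b) * (((1 - c) * (1 - c) * (A * ((1 - A) * ((1 - B) * (1 - B) * (C * ((1 - C))) + B * ((1 - B) * (C * ((1 - C))))))))
        + c * ((1 - c) * (A * ((1 - A) * (((1 - B) * (1 - B) * ((1 - C) * (1 - C) + C * ((1 - C)))) + B * ((1 - B) * ((1 - C) * (1 - C)
        + C * ((1 - C)))))))))))) + a * ((1 - a) * (((1 - b) * (1 - b) * (((1 - c) * (1 - c) * ((1 - A) * (1 - A) * (B * ((1 - B) * (C * ((1 - C)))))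
        + A * ((1 - A) * (B * ((1 - B) * (C * ((1 - C)))))))) + c * ((1 - c) * (((1 - A) * (1 - A) * (B * ((1 - B) * ((1 - C) * (1 - C) + C * ((1 - C))))))
        + A * ((1 - A) * (B * ((1 - B) * ((1 - C) * (1 - C) + C * ((1 - C))))))))))
        + b * ((1 - b) * (((1 - c) * (1 - c) * (((1 - A) * (1 - A) * ((1 - B) * (1 - B) * (C * ((1 - C))) + B * ((1 - B) * (C * ((1 - C))))))
        + A * ((1 - A) * ((1 - B) * (1 - B) * (C * ((1 - C))) + B * ((1 - B) * (C * ((1 - C))))))))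
        + c * ((1 - c) * (((1 - A) * (1 - A) * (((1 - B) * (1 - B) * ((1 - C) * (1 - C) + C * ((1 - C)))) + B * ((1 - B) * ((1 - C) * (1 - C)
        + C * ((1 - C)))))) + A * ((1 - A) * (((1 - B) * (1 - B) * ((1 - C) * (1 - C) + C * ((1 - C)))) + B * ((1 - B) * ((1 - C) * (1 - C)
        + C * ((1 - C))))))))))))) := by
  have hqz' : qz = (((1 - a) * (1 - A)) * ((1 - b) * (1 - B)) * ((1 - c) * (1 - C)) + (a * A + a * (1 - A)
      + (1 - a) * A) * ((1 - b) * (1 - B)) * ((1 - c) * (1 - C)) + ((1 - a) * (1 - A)) * (b * B + b * (1 - B)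
      + (1 - b) * B) * ((1 - c) * (1 - C)) + ((1 - a) * (1 - A)) * ((1 - b) * (1 - B)) * (c * C + c * (1 - C) + (1 - c) * C)) := by
    rw [hqz]; ring
  have hz₁' : z₁ = (a * A + a * (1 - A) + (1 - a) * A) * (b * B + b * (1 - B) + (1 - b) * B) * ((1 - c) * (1 - C)) := by
    rw [hz₁]; ring
  have hz₂' : z₂ = (a * A + a * (1 - A) + (1 - a) * A) * (c * C + c * (1 - C) + (1 - c) * C) * ((1 - b) * (1 - B)) := by
    rw [hz₂]; ring
  have hz₃' : z₃ = (b * B + b * (1 - B) + (1 - b) * B) * (c * C + c * (1 - C) + (1 - c) * C) * ((1 - a) * (1 - A)) := by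
    rw [hz₃]; ring
  have htz' : tz = (a * A + a * (1 - A) + (1 - a) * A) * (b * B + b * (1 - B) + (1 - b) * B) * (c * C + c * (1 - C) + (1 - c) * C) := by
    rw [htz]; ring
  exact (hubEdge_D3 rfl rfl rfl rfl rfl rfl hqz' hz₁' hz₂' hz₃' htz').ge

end CubicThreePointHub

end Summit.CriticalPhenomena.PercolationContinuityZ3.Theorems
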